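import Literature.NumberTheory.Automorphic.UnramifiedLocalHeckeIntegralGL2
import HarnessLib

/-!
# The unramified local DUAL Hecke integral of `GL₂` over `Fˣ`: `∫ W̃°(diag(a,1)) |a|^{s-1/2} d×a = vol · W°(1) · L(s, α⁻¹)`
# (Jacquet–Langlands (1970), Prop. 3.5 with Thm. 2.18: `Ψ(s, W̃°) = L(s, π̃)`, `π̃ = π ⊗ ω⁻¹` for `GL₂`)

Topic `NumberTheory/Automorphic`; namespace `Literature.NumberTheory.Automorphic`. Theorems only (no
definition, no named fact, no instance). The companion of `UnramifiedLocalHeckeIntegralGL2` for the involuted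
spherical Whittaker function `W̃°(g) = W°(w ᵗg⁻¹)` (`tildeFn`), the local input at the good places of the
dual Euler factorisation (`integral_dualHeckeIntegrand_pureTensor_eq_mul_tprod`, hypothesis `hunr`).

With the notation of `UnramifiedLocalHeckeIntegralGL2` (`v` spherical with Hecke eigenvalues of `α = {x₀, x₁}`,
`Λ` a `ψ`-Whittaker functional, `ψ` of conductor `𝒪`, `W° = whittakerModel π Λ v`), for `y = ϖ^m u`, `u ∈ 𝒪ˣ`:

  `W̃°(diag(y, 1)) = W°(w diag(y⁻¹, 1)) = W°(diag(1, y⁻¹) w) = W°(diag(1, y⁻¹))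
                   = W°((y⁻¹ · 1) diag(y, 1)) = e₂(α)^{-m} W°(diag(ϖ^m, 1))`,

because `w ∈ GL₂(𝒪)` fixes `v`, the scalar `u⁻¹ · 1 ∈ GL₂(𝒪)` fixes `v`, and the scalar `ϖ · 1` acts on `v`
through the TOP Hecke operator `T₂ = ρ(ϖ · 1)` (`heckeT_self_apply`) with eigenvalue `e₂(α) = x₀ x₁` — no
central character is needed. Summing the shells with the torus generating series at `t' = t / e₂(α)`
(`t = q^{-s}`; `xᵢ t' = x_{1-i}⁻¹ t`):

* `hasSum_whittakerModel_diagGL2_pow_of_norm_lt` — the generating series of `UnramifiedLocalHeckeIntegralGL2`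
  with a free variable `t`, `|xᵢ t| < 1`;
* `weylLong_two_mul_diagGL2`, `glTransposeInv_diagGL2`, `tildeFn_whittakerModel_diagGL2_of_mem_fixedPoints` —
  `W̃°(diag(y,1)) = Λ(π(diag(1, y⁻¹)) v)`;
* `apply_diagGL2_self_of_heckeT`, `apply_diagGL2_self_inv_pow_of_heckeT` — `π(ϖ · 1) v = e₂(α) v`,
  `π((ϖ · 1)^{-m}) v = e₂(α)^{-m} v`;
* `integrable_and_integral_tildeFn_whittakerModel_diagGL2_mul_cpow` (**main**) — for every Haar measure
  `μ'` on `Fˣ` and `|xᵢ⁻¹ q^{-s}| < 1`: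

    `∫_{Fˣ} W̃°(diag(a,1)) |a|^{s-1/2} dμ'(a) = μ'(𝒪ˣ) · Λ(v) · (∏_{a ∈ α} (1 - a⁻¹ q^{-s}))⁻¹`,

  with absolute convergence: the unramified standard `L`-factor of the contragredient, `L(s, α⁻¹)`
  (Jacquet–Langlands (1970), Prop. 3.5 and Thm. 2.18 (iv); Gelbart–Jacquet; Cogdell (2004), Thm. 3.3 with §6.1).

## References

* H. Jacquet, R. P. Langlands, *Automorphic Forms on GL(2)*, LNM 114 (1970), Prop. 3.5, Thm. 2.18
  [JacquetLanglands1970].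
* J. W. Cogdell, *Lectures on L-functions, converse theorems, and functoriality for GL_n* (2004), Thm. 3.3, §6.1
  [CogdellAnalyticTheory2004].
-/

noncomputable section

open scoped MatrixGroups NNReal ENNReal
open MeasureTheory ValuativeRel Polynomial Filter Finset
  Literature.NumberTheory.GaloisRepresentations.IsNonarchimedeanLocalField
  Literature.NumberTheory.EllipticCurves.Hida2000Thm326
open Literature.NumberTheory.GaloisRepresentations (glTransposeInv coe_glTransposeInv_apply)

namespace Literature.NumberTheory.Automorphic

/-! ### 1. The generating series with a free variable -/

section Series

variable {F : Type*} [Field F] [ValuativeRel F] [TopologicalSpace F] [IsNonarchimedeanLocalField F]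
  {V : Type*} [AddCommGroup V] [Module ℂ V] (π : Representation ℂ (GL (Fin 2) F) V)

/-- **The torus generating series of a spherical Whittaker function of `GL₂`, free variable**: for
`|a t| < 1` (`a ∈ α`), `∑_m W°(diag(ϖ^m, 1)) (q^{1/2} t)^m = Λ(v) · (∏_{a ∈ α} (1 - a t))⁻¹`.
[cite: Shintani1976, Theorem] [cite: JacquetLanglands1970, Prop. 3.5] -/
theorem hasSum_whittakerModel_diagGL2_pow_of_norm_lt {ϖ : Fˣ} (hϖ : (valuation F).IsUniformizer (ϖ : F))
    {ψ : AddChar F Circle} (hψ0 : ψ.HasConductorExp 0) {Λ : Module.Dual ℂ V}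
    (hΛ : Λ ∈ whittakerFunctionals π ψ) {v : V} (hv : v ∈ π.fixedPoints (glInt 2 F))
    {α : Multiset ℂ} {x : Fin 2 → ℂ} (hx : (univ : Finset (Fin 2)).val.map x = α)
    (hT : ∀ r, 1 ≤ r → r ≤ 2 → heckeT π ϖ r v =
      ((((Real.sqrt (residueFieldCard F)) ^ (r * (2 - r)) : ℝ) : ℂ) * α.esymm r) • v)
    {t : ℂ} (ht : ∀ a ∈ α, ‖a * t‖ < 1) :
    HasSum (fun m : ℕ => whittakerModel π Λ v (diagGL2 (ϖ ^ m) 1) *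
        (((Real.sqrt (residueFieldCard F) : ℝ) : ℂ) * t) ^ m)
      (Λ v * (((α.map fun a => (1 : ℂ[X]) - C a * X).prod).eval t)⁻¹) := by
  classical
  have hϖu : IsUniformizingElement (ϖ : F) := isUniformizingElement_of_isUniformizer hϖ
  have hϖ0 : (ϖ : F) ≠ 0 := hϖu.ne_zero
  have hmk : Units.mk0 (ϖ : F) hϖ0 = ϖ := Units.mk0_val _ _
  set sq : ℂ := ((Real.sqrt (residueFieldCard F) : ℝ) : ℂ) with hsq_def
  set ρ' : Representation ℂ (GL (Fin 1) F) ℂ := Representation.trivial ℂ (GL (Fin 1) F) ℂ with hρ'_def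
  have hW' : ∀ g, whittakerModel ρ' (LinearMap.id : Module.Dual ℂ ℂ) 1 g = 1 := fun g =>
    whittakerModel_trivial_apply LinearMap.id 1 g
  have hΛ' : (LinearMap.id : Module.Dual ℂ ℂ) ∈ whittakerFunctionals ρ' ψ := by
    rw [whittakerFunctionals_eq_top_of_fin_one]; exact Submodule.mem_top
  have hv'fix : (1 : ℂ) ∈ ρ'.fixedPoints (glInt 1 F) := by
    rw [Representation.mem_fixedPoints]
    intro k _
    rw [hρ'_def, Representation.trivial_apply]
  have hy : (univ : Finset (Fin 1)).val.map (fun _ : Fin 1 => (1 : ℂ)) = ({1} : Multiset ℂ) := rfl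
  have hT' : ∀ r, 1 ≤ r → r ≤ 1 → heckeT ρ' (Units.mk0 (ϖ : F) hϖu.ne_zero) r (1 : ℂ) =
      ((((Real.sqrt (residueFieldCard F)) ^ (r * (1 - r)) : ℝ) : ℂ) * ({1} : Multiset ℂ).esymm r) • (1 : ℂ) := by
    intro r hr1 hr2
    obtain rfl : r = 1 := le_antisymm hr2 hr1
    rw [heckeT_self_apply _ _ hv'fix, hρ'_def, Representation.trivial_apply, Nat.sub_self, mul_zero,
      pow_zero, Complex.ofReal_one, one_mul, Multiset.esymm, Multiset.powersetCard_one,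
      Multiset.map_singleton, Multiset.map_singleton, Multiset.prod_singleton, Multiset.sum_singleton,
      one_smul]
  have ht' : ∀ a ∈ α, ∀ b ∈ ({1} : Multiset ℂ), ‖a * b * t‖ < 1 := by
    intro a ha b hb
    rw [Multiset.mem_singleton.1 hb, mul_one]
    exact ht a ha
  have hS := hasSum_whittakerModel_cornerTorus (Nat.one_lt_two).le π ρ' hϖu hψ0 hψ0 hΛ hΛ' hv hv'fix hx hy
    (fun r hr1 hr2 => by rw [hmk]; exact hT r hr1 hr2) hT' ht'
  have hpi : ∀ N : ℕ, piPowGL hϖu.ne_zero (fun _ : Fin 1 => N) = glDiagonal 1 F (fun _ => ϖ ^ N) := by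
    intro N
    rw [← glDiagonal_det_eq (piPowGL hϖu.ne_zero _), det_piPowGL_fin_one, hmk]
  convert hS using 1
  · funext N
    simp only [piAntidiag_univ_fin_one, Finset.sum_singleton, torusExponent_fin_one, zpow_zero, one_mul,
      hW', hpi, glCorner_one_eq_diagGL2, det_glDiagonal_fin_one, ← hsq_def, mul_pow,
      show (2 - 1) * N = N by omega, mul_one]
    ring
  · rw [satakePairPolynomial_singleton_one, LinearMap.id_apply, mul_one]

end Series

/-! ### 2. `W̃°` on the torus -/

section Torus

variable {F : Type*} [Field F]

/-- `w diag(a, b) = diag(b, a) w` for the long Weyl element of `GL₂`. [folklore] -/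
theorem weylLong_two_mul_diagGL2 (a b : Fˣ) : weylLong 2 F * diagGL2 a b = diagGL2 b a * weylLong 2 F := by
  refine Matrix.GeneralLinearGroup.ext fun i j => ?_
  rw [Units.val_mul, Units.val_mul, coe_diagGL2, coe_diagGL2, coe_weylLong]
  fin_cases i <;> fin_cases j <;>
    simp [Matrix.mul_apply, Fin.sum_univ_two, Equiv.Perm.permMatrix, PEquiv.toMatrix_apply]

variable [TopologicalSpace F]

/-- `ι(diag(a, b)) = diag(a⁻¹, b⁻¹)`. [folklore] -/
theorem glTransposeInv_diagGL2 (a b : Fˣ) : glTransposeInv (Fin 2) F (diagGL2 a b) = diagGL2 a⁻¹ b⁻¹ := by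
  refine Matrix.GeneralLinearGroup.ext fun i j => ?_
  rw [coe_glTransposeInv_apply, diagGL2_inv_eq, Matrix.transpose_apply, coe_diagGL2]
  fin_cases i <;> fin_cases j <;> simp

variable [ValuativeRel F] {V : Type*} [AddCommGroup V] [Module ℂ V] (π : Representation ℂ (GL (Fin 2) F) V)

omit [TopologicalSpace F] in
/-- The long Weyl element lies in `GL₂(𝒪)`. [folklore] -/
private theorem weylLong_mem_glInt' : weylLong 2 F ∈ glInt 2 F := by
  refine mem_glInt_of_isIntegralMatrix (fun i j => ?_) ?_
  · rw [coe_weylLong]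
    fin_cases i <;> fin_cases j <;> simp [Equiv.Perm.permMatrix, PEquiv.toMatrix_apply]
  · have h : ((weylLong 2 F : GL (Fin 2) F) : Matrix (Fin 2) (Fin 2) F).det = -1 := by
      rw [coe_weylLong, Matrix.det_permutation, show Equiv.Perm.sign (Fin.revPerm : Equiv.Perm (Fin 2)) = -1 by decide]
      simp
    rw [h, Valuation.map_neg, Valuation.map_one]

/-- **`W̃°(diag(a,1)) = Λ(π(diag(1, a⁻¹)) v)`** for a `GL₂(𝒪)`-fixed `v`: `w ι(diag(a,1)) = diag(1, a⁻¹) w` and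
`w` fixes `v`. [folklore] -/
theorem tildeFn_whittakerModel_diagGL2_of_mem_fixedPoints (Λ : Module.Dual ℂ V) {v : V}
    (hv : v ∈ π.fixedPoints (glInt 2 F)) (a : Fˣ) :
    tildeFn (whittakerModel π Λ v) (diagGL2 a 1) = Λ (π (diagGL2 1 a⁻¹) v) := by
  rw [tildeFn_apply, whittakerModel_apply, glTransposeInv_diagGL2, inv_one, weylLong_two_mul_diagGL2, map_mul,
    Module.End.mul_apply, (π.mem_fixedPoints _ v).1 hv _ weylLong_mem_glInt']

variable [IsNonarchimedeanLocalField F]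

/-- **The scalar `ϖ · 1` acts on a spherical Hecke eigenvector by `e₂(α)`** (the top Hecke operator
`T₂ = ρ(ϖ · 1)`, `heckeT_self_apply`). [cite: CartierCorvallis1979, §IV.2] -/
theorem apply_diagGL2_self_of_heckeT {ϖ : Fˣ} {v : V} (hv : v ∈ π.fixedPoints (glInt 2 F)) {α : Multiset ℂ}
    (hT : ∀ r, 1 ≤ r → r ≤ 2 → heckeT π ϖ r v =
      ((((Real.sqrt (residueFieldCard F)) ^ (r * (2 - r)) : ℝ) : ℂ) * α.esymm r) • v) :
    π (diagGL2 ϖ ϖ) v = α.esymm 2 • v := by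
  have h := hT 2 (by norm_num) le_rfl
  rw [heckeT_self_apply π ϖ hv, Nat.sub_self, mul_zero, pow_zero, Complex.ofReal_one, one_mul] at h
  have hdiag : heckeDiag 2 ϖ 2 = diagGL2 ϖ ϖ := by
    refine Matrix.GeneralLinearGroup.ext fun i j => ?_
    rw [coe_heckeDiag, coe_diagGL2]
    fin_cases i <;> fin_cases j <;> simp
  rw [← hdiag, h]

/-- Hence `π((ϖ · 1)⁻¹)^m v = e₂(α)^{-m} v` (for `e₂(α) ≠ 0`). [folklore] -/
theorem apply_diagGL2_self_inv_pow_of_heckeT {ϖ : Fˣ} {v : V} (hv : v ∈ π.fixedPoints (glInt 2 F))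
    {α : Multiset ℂ} (hT : ∀ r, 1 ≤ r → r ≤ 2 → heckeT π ϖ r v =
      ((((Real.sqrt (residueFieldCard F)) ^ (r * (2 - r)) : ℝ) : ℂ) * α.esymm r) • v)
    (he : α.esymm 2 ≠ 0) (m : ℕ) :
    π (diagGL2 ϖ⁻¹ ϖ⁻¹ ^ m) v = (α.esymm 2)⁻¹ ^ m • v := by
  have h1 : π (diagGL2 ϖ⁻¹ ϖ⁻¹) v = (α.esymm 2)⁻¹ • v := by
    have h := apply_diagGL2_self_of_heckeT π hv hT
    have hinv : diagGL2 ϖ⁻¹ ϖ⁻¹ = (diagGL2 ϖ ϖ)⁻¹ := (diagGL2_inv_eq ϖ ϖ).symm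
    have h2 : π (diagGL2 ϖ⁻¹ ϖ⁻¹) (π (diagGL2 ϖ ϖ) v) = v := by
      rw [hinv, ← Module.End.mul_apply, ← map_mul, inv_mul_cancel, map_one, Module.End.one_apply]
    rw [h, map_smul] at h2
    calc π (diagGL2 ϖ⁻¹ ϖ⁻¹) v = (α.esymm 2)⁻¹ • (α.esymm 2 • π (diagGL2 ϖ⁻¹ ϖ⁻¹) v) := by
          rw [smul_smul, inv_mul_cancel₀ he, one_smul]
      _ = (α.esymm 2)⁻¹ • v := by rw [h2]
  induction m with
  | zero => rw [pow_zero, pow_zero, map_one, one_smul, Module.End.one_apply]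
  | succ m ih => rw [pow_succ, map_mul, Module.End.mul_apply, h1, map_smul, ih, smul_smul, ← pow_succ']

end Torus

/-! ### 3. The unramified dual Hecke integral -/

section Spherical

variable {F : Type*} [Field F] [ValuativeRel F] [TopologicalSpace F] [IsNonarchimedeanLocalField F]
  {V : Type*} [AddCommGroup V] [Module ℂ V] (π : Representation ℂ (GL (Fin 2) F) V)
  [MeasurableSpace F] [BorelSpace F]

/-- **Absolute convergence and value of the unramified local DUAL Hecke integral of `GL₂`.** With the
notation of the file docstring (`α = {x₀, x₁}`, `xᵢ ≠ 0`), for every Haar measure `μ'` on `Fˣ` and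
`|xᵢ⁻¹ q^{-s}| < 1`, the function `a ↦ W̃°(diag(a,1)) |a|^{s-1/2}` is `μ'`-integrable and

  `∫_{Fˣ} W̃°(diag(a,1)) |a|^{s-1/2} dμ'(a) = μ'(𝒪ˣ) · Λ(v) · (∏_{a ∈ α} (1 - a⁻¹ q^{-s}))⁻¹`.

[cite: JacquetLanglands1970, Prop. 3.5, Thm. 2.18 (iv)] [cite: CogdellAnalyticTheory2004, Thm. 3.3, §6.1] -/
theorem integrable_and_integral_tildeFn_whittakerModel_diagGL2_mul_cpow {ϖ : Fˣ}
    (hϖ : (valuation F).IsUniformizer (ϖ : F))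
    {ψ : AddChar F Circle} (hψ0 : ψ.HasConductorExp 0) {Λ : Module.Dual ℂ V}
    (hΛ : Λ ∈ whittakerFunctionals π ψ) {v : V} (hv : v ∈ π.fixedPoints (glInt 2 F))
    {α : Multiset ℂ} {x : Fin 2 → ℂ} (hx : (univ : Finset (Fin 2)).val.map x = α)
    (hx0 : ∀ i, x i ≠ 0)
    (hT : ∀ r, 1 ≤ r → r ≤ 2 → heckeT π ϖ r v =
      ((((Real.sqrt (residueFieldCard F)) ^ (r * (2 - r)) : ℝ) : ℂ) * α.esymm r) • v)
    (μ' : Measure Fˣ) [μ'.IsHaarMeasure]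
    {s : ℂ} (hs : ∀ a ∈ α, ‖a⁻¹ * (residueFieldCard F : ℂ) ^ (-s)‖ < 1) :
    Integrable (fun a : Fˣ => tildeFn (whittakerModel π Λ v) (diagGL2 a 1) *
        (((normAbs F (a : F) : ℝ≥0) : ℝ) : ℂ) ^ (s - 1 / 2)) μ' ∧
    ∫ a, tildeFn (whittakerModel π Λ v) (diagGL2 a 1) * (((normAbs F (a : F) : ℝ≥0) : ℝ) : ℂ) ^ (s - 1 / 2) ∂μ' =
      (μ' {x : Fˣ | valuation F (x : F) = 1}).toReal *
        (Λ v * ((((α.map (·⁻¹)).map fun a => (1 : ℂ[X]) - C a * X).prod).eval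
          ((residueFieldCard F : ℂ) ^ (-s)))⁻¹) := by
  classical
  haveI : T2Space F := (isLocalField F).toT2Space
  haveI : BorelSpace Fˣ := Units.borelSpace
  have hϖu : IsUniformizingElement (ϖ : F) := isUniformizingElement_of_isUniformizer hϖ
  have hϖn : normAbs F (ϖ : F) = (residueFieldCard F : ℝ≥0)⁻¹ := normAbs_uniformizer_holds hϖ
  have hpow : ∀ k : ℕ, diagGL2 (ϖ⁻¹ ^ k) (ϖ⁻¹ ^ k) = diagGL2 ϖ⁻¹ ϖ⁻¹ ^ k := fun k => by
    induction k with
    | zero => rw [pow_zero, pow_zero, diagGL2_one]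
    | succ k ih => rw [pow_succ, pow_succ, diagGL2_mul, ih]
  set t : ℂ := (residueFieldCard F : ℂ) ^ (-s) with ht_def
  set sq : ℂ := ((Real.sqrt (residueFieldCard F) : ℝ) : ℂ) with hsq_def
  -- the multiset `α = {x₀, x₁}` and `e₂(α) = x₀ x₁`
  have hprod : α.prod = x 0 * x 1 := by rw [← hx, Finset.prod_map_val, Fin.prod_univ_two]
  have he : α.esymm 2 = x 0 * x 1 := by
    have hcard : Multiset.card α = 2 := by rw [← hx, Multiset.card_map, Finset.card_val, Finset.card_fin]
    have h := multisetEsymm_card_eq_prod α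
    rw [hcard] at h
    rw [h, hprod]
  have he0 : α.esymm 2 ≠ 0 := by rw [he]; exact mul_ne_zero (hx0 0) (hx0 1)
  set e : ℂ := α.esymm 2 with he_def
  set t' : ℂ := t * e⁻¹ with ht'_def
  have hmem : ∀ a ∈ α, a = x 0 ∨ a = x 1 := by
    intro a ha
    rw [← hx, Multiset.mem_map] at ha
    obtain ⟨i, -, rfl⟩ := ha
    fin_cases i
    · exact Or.inl rfl
    · exact Or.inr rfl
  have hx0mem : x 0 ∈ α := by rw [← hx]; exact Multiset.mem_map_of_mem _ (Finset.mem_univ_val 0)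
  have hx1mem : x 1 ∈ α := by rw [← hx]; exact Multiset.mem_map_of_mem _ (Finset.mem_univ_val 1)
  have ht' : ∀ a ∈ α, ‖a * t'‖ < 1 := by
    intro a ha
    rcases hmem a ha with rfl | rfl
    · have : x 0 * t' = (x 1)⁻¹ * t := by rw [ht'_def, he]; field_simp [hx0 0, hx0 1]
      rw [this]; exact hs _ hx1mem
    · have : x 1 * t' = (x 0)⁻¹ * t := by rw [ht'_def, he]; field_simp [hx0 0, hx0 1]
      rw [this]; exact hs _ hx0mem
  -- the two Euler products agree: `∏_{a ∈ α} (1 - a t') = ∏_{a ∈ α} (1 - a⁻¹ t)`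
  have hpoly : (((α.map fun a => (1 : ℂ[X]) - C a * X).prod).eval t') =
      ((((α.map (·⁻¹)).map fun a => (1 : ℂ[X]) - C a * X).prod).eval t) := by
    rw [Multiset.map_map, ← hx, Multiset.map_map, Multiset.map_map, Finset.prod_map_val, Finset.prod_map_val,
      Polynomial.eval_prod, Polynomial.eval_prod, Fin.prod_univ_two, Fin.prod_univ_two]
    simp only [Function.comp_apply, eval_sub, eval_one, eval_mul, eval_C, eval_X]
    rw [ht'_def, he]
    field_simp [hx0 0, hx0 1]
  -- the shell values and their generating series (at `t'`)
  set w : ℕ → ℂ := fun m => whittakerModel π Λ v (diagGL2 (ϖ ^ m) 1) * (sq * t') ^ m with hw_def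
  have hS : HasSum w (Λ v * (((α.map fun a => (1 : ℂ[X]) - C a * X).prod).eval t')⁻¹) :=
    hasSum_whittakerModel_diagGL2_pow_of_norm_lt π hϖ hψ0 hΛ hv hx hT ht'
  have hsum : Summable fun m => ‖w m‖ := summable_norm_iff.2 hS.summable
  -- the integrand and its shell description
  have hr0 : (0 : ℝ) < (((residueFieldCard F : ℝ≥0)⁻¹ : ℝ≥0) : ℝ) := by
    exact_mod_cast inv_residueFieldCard_pos (F := F)
  set f : Fˣ → ℂ := fun a => tildeFn (whittakerModel π Λ v) (diagGL2 a 1) *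
    (((normAbs F (a : F) : ℝ≥0) : ℝ) : ℂ) ^ (s - 1 / 2) with hf_def
  -- `W̃°(diag(a,1)) = Λ(π(diag(a,1)) π(diag(a⁻¹,a⁻¹)) v)`
  have htilde : ∀ a : Fˣ, tildeFn (whittakerModel π Λ v) (diagGL2 a 1) =
      Λ (π (diagGL2 a 1) (π (diagGL2 a⁻¹ a⁻¹) v)) := by
    intro a
    rw [tildeFn_whittakerModel_diagGL2_of_mem_fixedPoints π Λ hv, ← Module.End.mul_apply, ← map_mul, ← diagGL2_mul,
      mul_inv_cancel, one_mul]
  have hf0 : ∀ a : Fˣ, 1 < normAbs F (a : F) → f a = 0 := fun a ha => by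
    simp only [hf_def]
    rw [htilde, ← whittakerModel_apply, whittakerModel_diagGL2_eq_zero_of_one_lt π hψ0 hΛ ?_ ha, zero_mul]
    -- `π(diag(a⁻¹,a⁻¹)) v` is again `GL₂(𝒪)`-fixed (the scalar is central)
    rw [Representation.mem_fixedPoints]
    intro k hk
    rw [← Module.End.mul_apply, ← map_mul,
      show k * diagGL2 a⁻¹ a⁻¹ = diagGL2 a⁻¹ a⁻¹ * k from ?_, map_mul, Module.End.mul_apply,
      (π.mem_fixedPoints _ v).1 hv k hk]
    refine Matrix.GeneralLinearGroup.ext fun i j => ?_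
    rw [Units.val_mul, Units.val_mul, coe_diagGL2, show (!![((a⁻¹ : Fˣ) : F), 0; 0, ((a⁻¹ : Fˣ) : F)] :
        Matrix (Fin 2) (Fin 2) F) = ((a⁻¹ : Fˣ) : F) • (1 : Matrix (Fin 2) (Fin 2) F) by
      ext i j; fin_cases i <;> fin_cases j <;> simp, Matrix.mul_smul, Matrix.smul_mul, Matrix.mul_one,
      Matrix.one_mul]
  have hfv : ∀ (m : ℕ) (a : Fˣ), normAbs F (a : F) = ((residueFieldCard F : ℝ≥0)⁻¹) ^ (m : ℤ) →
      f a = w m := by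
    intro m a ha
    set u : Fˣ := (ϖ ^ m)⁻¹ * a with hu_def
    have hau : a = ϖ ^ m * u := by rw [hu_def, mul_inv_cancel_left]
    have hu : valuation F (u : F) = 1 := by
      rw [← normAbs_eq_one_iff_valuation_eq_one, hu_def, Units.val_mul, Units.val_inv_eq_inv_val,
        Units.val_pow_eq_pow_val, map_mul, map_inv₀, map_pow, hϖn, ha, zpow_natCast, inv_mul_cancel₀]
      exact pow_ne_zero _ inv_residueFieldCard_pos.ne'
    have hui : valuation F ((u⁻¹ : Fˣ) : F) = 1 := by
      rw [Units.val_inv_eq_inv_val, map_inv₀, hu, inv_one]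
    -- `π(diag(a⁻¹,a⁻¹)) v = e^{-m} v`
    have hcentral : π (diagGL2 a⁻¹ a⁻¹) v = e⁻¹ ^ m • v := by
      rw [hau, mul_inv, show (ϖ ^ m)⁻¹ = ϖ⁻¹ ^ m from inv_pow _ _, diagGL2_mul, map_mul, Module.End.mul_apply,
        (π.mem_fixedPoints _ v).1 hv _ (diagGL2_mem_glInt hui hui),
        hpow m, apply_diagGL2_self_inv_pow_of_heckeT π hv hT he0 m]
    have hWa : whittakerModel π Λ v (diagGL2 a 1) = whittakerModel π Λ v (diagGL2 (ϖ ^ m) 1) := by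
      rw [hau, whittakerModel_diagGL2_mul_of_valuation_eq_one π Λ hv _ hu]
    have habs : (((normAbs F (a : F) : ℝ≥0) : ℝ) : ℂ) ^ (s - 1 / 2) = (sq * t) ^ m := by
      rw [ha, NNReal.coe_zpow, ofReal_zpow_cpow hr0, inv_residueFieldCard_cpow_sub_one_half, zpow_natCast]
    simp only [hf_def, hw_def]
    rw [htilde, hcentral, map_smul, map_smul, smul_eq_mul, ← whittakerModel_apply, hWa, habs, ht'_def]
    rw [mul_pow, mul_pow, mul_pow, inv_pow]
    ring
  -- measurability: a shell function is locally constant (`|·|` is locally constant on `Fˣ`)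
  have hcont : Continuous f := by
    refine IsLocallyConstant.continuous ((IsLocallyConstant.iff_exists_open f).2 fun a => ?_)
    refine ⟨{b : Fˣ | normAbs F (b : F) = normAbs F (a : F)}, (isLocallyConstant_normAbs_units (F := F)).isOpen_fiber _,
      rfl, fun b hb => ?_⟩
    obtain ⟨k, hk⟩ := exists_normAbs_eq_inv_zpow a.ne_zero
    by_cases hk0 : 0 ≤ k
    · obtain ⟨m, rfl⟩ : ∃ m : ℕ, k = m := ⟨k.toNat, (Int.toNat_of_nonneg hk0).symm⟩
      rw [hfv m a hk, hfv m b (hb.trans hk)]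
    · have h1 : 1 < normAbs F (a : F) := by
        rw [hk, ← zpow_zero ((residueFieldCard F : ℝ≥0)⁻¹)]
        exact (zpow_right_strictAnti₀ inv_residueFieldCard_pos inv_residueFieldCard_lt_one) (lt_of_not_ge hk0)
      rw [hf0 a h1, hf0 b (hb ▸ h1)]
  refine ⟨integrable_units_of_shell μ' hcont.aestronglyMeasurable hf0 hfv hsum, ?_⟩
  rw [integral_units_eq_tsum_shell μ' hf0 hfv hsum, hS.tsum_eq, hpoly]

end Spherical

end Literature.NumberTheory.Automorphic
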